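import Summits.BirchSwinnertonDyer.BirchSwinnertonDyer.Theorems.ManinLocalTwoThreePinningOneSeventySixRows
import Summits.BirchSwinnertonDyer.BirchSwinnertonDyer.Theorems.ManinLocalTwoThreePhiFortyFourCuspForm
import Summits.BirchSwinnertonDyer.BirchSwinnertonDyer.Theorems.ManinLocalTwoThreeTwistDefectRootCurves
import Summits.BirchSwinnertonDyer.BirchSwinnertonDyer.Theorems.ManinLocalTwoThreeEtaIdentitiesFortyFour
import Summits.BirchSwinnertonDyer.BirchSwinnertonDyer.Theorems.ManinLocalTwoThreeBracketSturmEightyEight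
import Summits.BirchSwinnertonDyer.BirchSwinnertonDyer.Theorems.ManinLocalTwoThreeBracketSturmLists
import Literature.NumberTheory.EllipticCurves.CuspFormTwist
import Literature.NumberTheory.EllipticCurves.QuadraticTwistNegOneLFunctionProofs
import HarnessLib

/-!
# Level 176 = 2⁴·11 (C2 domain `4 ∣ 176`; genus 19; THREE classes `176a–c`, all `χ₋₄`-twists): `|c| = 1` on the rows `176c = (44a)^{χ₋₄}` and
# `176a = (88a)^{χ₋₄}` — UNCONDITIONALLY and DATUM-FREE

Cell `bsd-f2-manin`, route `ManinLocalTwoThree`, crux C2 `ManinOddAtFour` (stmt-BirchSwinnertonDyer-22967: `2² ∣ 176`); prover seat p2 gen 31; `--supports`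
(helper).  ASSEMBLY of: an g55's FACT-FREE kernel pinning of level `176` and its row identification (`PinningOneSeventySix.f_eq_charTwist_or`,
`cuspCoeff_f_eq_chi_mul`, rows selected by `a₃(W) ∈ {−1, 1, 3}`); desc's `χ₋₄`-squeeze transport (`TwistDefect.abs_maninConstant_eq_one_of_squeeze_negOneTwist_aligned_level`,
`…oneSeventySixC_of_cuspCoeff`); p3's squeeze `(S2)₄₄` (`LevelFortyFour.periodLatticeLe_fortyFour`); this seat's datum-free root inputs
(`LevelFortyFour.exists_cuspForm_phi44`, `cuspCoeff_eq_zero_phi44`, `ne_zero_of_coe_eq_Phi44`) and, for the row `176a`, an EXPLICIT root cusp form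
`F₈₈ = −4·Q2 + Q3 ∈ S₂(Γ₀(88))` (`Q2 = η₄³η₄₄³/(η₂η₂₂)`, `Q3 = η₂³η₂₂³/(η₄η₄₄)`, `EtaCert` cusp forms) with (I1) `(S2)₈₈ₐ` from this seat's Bracket–Sturm
certificate of `88a` (gen 30: `…BracketSturmEightyEight`, re-assembled here to the lattice inclusion `Λ(F₈₈) ⊆ Λ_{88a1}`), (I2) `a₂ₖ(F₈₈) = 0` by `η`-parity,
the aligned edge `88a1 ⊗ (−1) = 176a1 = [0,0,0,−4,−4]`, and the `176a` row re-proved against `F₈₈`'s own table (no `X₀(88)`-datum).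
RESULTS: `abs_maninConstant_eq_one_oneSeventySix_of_lFunction_three_eq_neg_one` (`176c`, `a₃(W) = −1`) and `…_of_lFunction_three_eq_three`
(`176a`, `a₃(W) = 3`): `|c(D)| = 1` for every lattice-optimal `X₀(176)`-datum on these rows.  The row `176b = (11a)^{χ₋₄}` (`a₃(W) = 1`) is NOT
closed here (its root `φ₁₁` has `a₂ = −2 ≠ 0`: the half-period transport needs a `2`-depleted root — open).
HONEST FRAMING: unconditional (standard axioms); two of three rows of ONE level of C2 — nothing here proves C2 for all `N`, Manin's conjecture or BSD;
item 22967 stays OPEN as filed.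
[cite: Manin1972, Prop. 1.4] [cite: AgasheRibetStein2006, §§1–2] [cite: Stevens1989, Lemma (5.4) p. 97] [cite: Pal2012, Prop. 2.4]
[cite: CremonaAlgorithms1997, §2.10, Table 1 (44a1, 88a1, 176a1, 176c1), Table 3 (N = 176)] [cite: Shimura1971, Prop. 3.64] [cite: Sturm1987, Thm. 1]
[cite: Ligozat1975, Ch. 3] [cite: Koehler2011, §2.1]
-/

set_option autoImplicit false
-- lint-debt: the directory name repeats the summit name (sibling precedent `ManinLocalTwoThreeManinConstantOneTwentyEight.lean`)
set_option linter.dupNamespace false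

noncomputable section

open Complex Filter Topology Set Function
open UpperHalfPlane hiding I
open scoped Real Topology MatrixGroups ModularForm
open ModularForm CongruenceSubgroup PowerSeries
open Literature.NumberTheory.ModularForms
open Literature.NumberTheory.EllipticCurves Literature.NumberTheory.EllipticCurves.ModularForms
open Literature.NumberTheory.Automorphic

namespace Summit.BirchSwinnertonDyer.BirchSwinnertonDyer.Theorems.ManinLocalTwoThree.LevelOneSeventySix

open TwistDefect EtaParity LevelFortyFour PinningOneSeventySix PinningKernel BracketSturm WeierstrassCurve

/-! ## §1 Row `176c` (`a₃(W) = −1`): desc's transport from the root `44a`, with datum-free root inputs -/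

/-- **`176c`: `|c(D)| = 1` for every lattice-optimal `X₀(176)`-datum with `a₃(W) = −1`** — UNCONDITIONAL and datum-free (root cusp form
`φ` with `⇑φ = ⇑Φ₄₄` from `exists_cuspForm_phi44`; `(S2)₄₄` = p3; `a₂ₖ(Φ₄₄) = 0` = η-parity; the row = an's `cuspCoeff_f_eq_chi_mul`).
[cite: AgasheRibetStein2006, §§1–2] [cite: CremonaAlgorithms1997, Table 1 (44a1, 176c1)] -/
theorem abs_maninConstant_eq_one_oneSeventySix_of_lFunction_three_eq_neg_one (W : WeierstrassCurve ℚ) [W.IsElliptic] [W.IsGloballyMinimal]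
    (D : ModularParametrizationData W 176) (h3 : W.LFunction 3 = -1)
    (hopt : ∀ z ∈ D.L.lattice, ∃ w ∈ periodLattice D.f, z = D.c * w) : |D.maninConstant| = 1 := by
  obtain ⟨φ, hφ⟩ := exists_cuspForm_phi44
  exact abs_maninConstant_eq_one_oneSeventySixC_of_cuspCoeff φ (periodLatticeLe_fortyFour φ (ne_zero_of_coe_eq_Phi44 φ hφ) hφ)
    (cuspCoeff_eq_zero_phi44 φ hφ) W D (fun n _ ↦ cuspCoeff_f_eq_chi_mul D φ hφ h3 n) hopt

/-! ## §2 The root cusp form `F₈₈ = −4·Q2 + Q3 ∈ S₂(Γ₀(88))` of the row `176a` -/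

/-- Exponent list of `Q2 = η₄³η₄₄³/(η₂η₂₂)`. [folklore] -/
def lQ2 : List (ℕ × ℤ) := [(2, -1), (4, 3), (22, -1), (44, 3)]
/-- Exponent list of `Q3 = η₂³η₂₂³/(η₄η₄₄)`. [folklore] -/
def lQ3 : List (ℕ × ℤ) := [(2, 3), (4, -1), (22, 3), (44, -1)]

/-- `Q2` is an `η`-quotient CUSP form of weight `2` on `Γ₀(88)` (`∏ δ^|r_δ| = 15488²`; Ligozat orders `1,1,5,5,1,1,5,5 > 0`). [cite: Ligozat1975, Ch. 3] -/
theorem etaCert_Q2 : EtaCert 88 lQ2 15488 := by unfold lQ2; decide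
/-- `Q3` is an `η`-quotient CUSP form of weight `2` on `Γ₀(88)` (`∏ δ^|r_δ| = 3872²`). [cite: Ligozat1975, Ch. 3] -/
theorem etaCert_Q3 : EtaCert 88 lQ3 3872 := by unfold lQ3; decide

/-- `Q2 ∈ S₂(Γ₀(88))`. [cite: Ligozat1975, Ch. 3] -/
def Q2c : CuspForm (Gamma0 88) 2 := etaQuotientCuspForm 88 (expFn lQ2) 2 (by decide) (newmanCond_of_etaCert etaCert_Q2) etaCert_Q2.2.2.2.2
/-- `Q3 ∈ S₂(Γ₀(88))`. [cite: Ligozat1975, Ch. 3] -/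
def Q3c : CuspForm (Gamma0 88) 2 := etaQuotientCuspForm 88 (expFn lQ3) 2 (by decide) (newmanCond_of_etaCert etaCert_Q3) etaCert_Q3.2.2.2.2

/-- **The root cusp form `F₈₈ = −4·Q2 + Q3 ∈ S₂(Γ₀(88))`** (underlying function = `f₈₈ₐ` of `…ManinConstantEightyEight.f_apply_eq_eightyEight`). [folklore] -/
def F88 : CuspForm (Gamma0 88) 2 := (-4 : ℂ) • Q2c + Q3c

/-- `F₈₈` pointwise. [folklore] -/
theorem coe_F88 : (⇑F88 : ℍ → ℂ) = fun τ ↦ -4 * etaQuotient 88 (expFn [(2, -1), (4, 3), (22, -1), (44, 3)]) τ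
    + etaQuotient 88 (expFn [(2, 3), (4, -1), (22, 3), (44, -1)]) τ := by
  funext τ
  rw [F88, CuspForm.add_apply, CuspForm.IsGLPos.smul_apply, smul_eq_mul]
  rfl

/-! ### (I2) `a₂ₖ(F₈₈) = 0` by `η`-parity (both quotients even-supported, half-shift sign `−1`) -/

/-- Half-shift exponent of `Q2`: `60`. -/
theorem sum_half_Q2 : (∑ δ ∈ (88 : ℕ).divisors, ((δ / 2 : ℕ) : ℤ) * expFn [(2, -1), (4, 3), (22, -1), (44, 3)] δ) = 60 := by decide
/-- Half-shift exponent of `Q3`: `12`. -/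
theorem sum_half_Q3 : (∑ δ ∈ (88 : ℕ).divisors, ((δ / 2 : ℕ) : ℤ) * expFn [(2, 3), (4, -1), (22, 3), (44, -1)] δ) = 12 := by decide
/-- `Q2` is supported on even `δ`. -/
theorem support_even_Q2 : ∀ δ ∈ (88 : ℕ).divisors, ¬ 2 ∣ δ → expFn [(2, -1), (4, 3), (22, -1), (44, 3)] δ = 0 := by decide
/-- `Q3` is supported on even `δ`. -/
theorem support_even_Q3 : ∀ δ ∈ (88 : ℕ).divisors, ¬ 2 ∣ δ → expFn [(2, 3), (4, -1), (22, 3), (44, -1)] δ = 0 := by decide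

/-- **(I2) for `88a`: `a₂ₖ(F₈₈) = 0`.** [folklore] -/
theorem cuspCoeff_F88_eq_zero (n : ℕ) (hn : 2 ∣ n) : cuspCoeff F88 n = 0 := by
  refine cuspCoeff_eq_zero_of_half_vadd_gamma0 F88 (fun τ ↦ ?_) n hn
  rw [coe_F88]
  simp only
  rw [etaQuotient_half_vadd 88 _ support_even_Q2 τ, sum_half_Q2, cexp_eq_neg_one_of_eq 60 2 (by norm_num),
    etaQuotient_half_vadd 88 _ support_even_Q3 τ, sum_half_Q3, cexp_twelve]
  ring

/-! ### (I1) `(S2)₈₈ₐ`: `Λ(F₈₈) ⊆ Λ_{88a1}` from the Bracket–Sturm certificate of `88a` -/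

/-- `F₈₈ ≠ 0` (`a₁ = 1`). [folklore] -/
theorem F88_ne_zero : F88 ≠ 0 := by
  obtain ⟨F, hF, hFcoe⟩ := LevelEightyEight.exists_formF_eightyEight
  have hc := coeff_eq_of_coe_eq (coe_F88.trans hFcoe.symm) hF
  have h1 := hc 1 (by norm_num)
  intro h0
  rw [h0, CuspForm.coe_zero, UpperHalfPlane.qExpansion_zero, map_zero] at h1
  norm_num at h1

/-- **`(S2)₈₈ₐ`: every period of `F₈₈` lies in the Néron lattice of `88a1 = [0,0,0,−4,4]`** (Bracket–Sturm certificate of gen 30, depth `145`,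
re-assembled to the lattice inclusion). [cite: Manin1972, Prop. 1.4] [cite: Sturm1987, Thm. 1] [cite: CremonaAlgorithms1997, §2.10] -/
theorem periodLatticeLe_eightyEightA {L₀ : PeriodPair} (hL₀ : IsNeronLatticeOf ((⟨0, 0, 0, -4, 4⟩ : WeierstrassCurve ℚ).baseChange ℂ) L₀) :
    ∀ z ∈ periodLattice F88, z ∈ L₀.lattice := by
  obtain ⟨A, B, hA, hB⟩ := LevelEightyEight.exists_formsAB_eightyEight
  obtain ⟨F, hF, hFcoe⟩ := LevelEightyEight.exists_formF_eightyEight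
  have hc := coeff_eq_of_coe_eq (coe_F88.trans hFcoe.symm) hF
  obtain ⟨hc₂, hc₃⟩ := LevelEightyEight.neron_invariants_eightyEightA1 hL₀
  obtain ⟨h0, hBne, hCne⟩ := defectForm_coeff_eq_zero_of_defectList A B F88 L₀.g₂ L₀.g₃ _ _ _ hA hB hc 216 864 (3456) (-3456)
    (by norm_num) (by norm_num) hc₂ hc₃ (forall_getD_eq_zero_of_eq_replicate LevelEightyEight.defectList_eq_eightyEight)
    LevelEightyEight.hBnz_eightyEight LevelEightyEight.hCnz_eightyEight
  exact periodLattice_le_of_defectForm_eq_zero F88 F88_ne_zero L₀ A B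
    (modularForm_eq_zero_of_coeff_eq_zero _ h0 LevelEightyEight.sturm_eightyEight) hBne hCne

/-! ### The aligned edge `88a1 ⊗ (−1) = 176a1 = [0,0,0,−4,−4]` -/

/-- `Δ, c₄, c₆` of `176a1 = [0,0,0,−4,−4]`: `−2⁸·11, 192, 3456`. [cite: CremonaAlgorithms1997, Table 1 (176a1)] -/
theorem invariants_oneSeventySixA1 :
    Literature.NumberTheory.EllipticCurves.Rank1Residual.X11RankOneCertificates.discOf [0, 0, 0, -4, -4] = -2816 ∧
    Literature.NumberTheory.EllipticCurves.Rank1Residual.X11RankOneCertificates.c4Of [0, 0, 0, -4, -4] = 192 ∧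
    Literature.NumberTheory.EllipticCurves.Rank1Residual.X11RankOneCertificates.c6Of [0, 0, 0, -4, -4] = 3456 := by
  refine ⟨?_, ?_, ?_⟩ <;> decide

/-- `176a1` (integer-cast model) is globally minimal (`|Δ| = 2⁸·11`, Kraus). [cite: SilvermanAEC2009, VII.1 Remark 1.1] -/
theorem isGloballyMinimal_oneSeventySixA1_cast :
    (⟨((0 : ℤ) : ℚ), ((0 : ℤ) : ℚ), ((0 : ℤ) : ℚ), ((-4 : ℤ) : ℚ), ((-4 : ℤ) : ℚ)⟩ : WeierstrassCurve ℚ).IsGloballyMinimal := by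
  obtain ⟨hD, -, -⟩ := invariants_oneSeventySixA1
  refine WeierstrassCurve.isGloballyMinimal_of_int_kraus 0 0 0 (-4) (-4) fun q hq ↦ Or.inl fun h ↦ ?_
  obtain ⟨h12, -⟩ := h
  rw [hD] at h12
  have hq1 : (q : ℤ) ∣ 2816 := dvd_neg.mp (dvd_trans (dvd_pow_self _ (by norm_num)) h12)
  have hdvdN : q ∣ 2 ^ 8 * 11 := by
    have e : ((2 ^ 8 * 11 : ℕ) : ℤ) = 2816 := by norm_num
    exact Int.natCast_dvd_natCast.mp (e ▸ hq1)
  have hpi := Nat.Prime.prime hq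
  rcases hpi.dvd_or_dvd hdvdN with h | h
  · have := (Nat.prime_dvd_prime_iff_eq hq Nat.prime_two).mp (hpi.dvd_of_dvd_pow h)
    subst this; revert h12; norm_num
  · have := (Nat.prime_dvd_prime_iff_eq hq (by norm_num : Nat.Prime 11)).mp h
    subst this; revert h12; norm_num

/-- `176a1 = [0,0,0,−4,−4]` is globally minimal. [cite: SilvermanAEC2009, VII.1 Remark 1.1] -/
theorem isGloballyMinimal_oneSeventySixA1 : (⟨0, 0, 0, -4, -4⟩ : WeierstrassCurve ℚ).IsGloballyMinimal := by
  rw [show (⟨0, 0, 0, -4, -4⟩ : WeierstrassCurve ℚ) = ⟨((0 : ℤ) : ℚ), ((0 : ℤ) : ℚ), ((0 : ℤ) : ℚ), ((-4 : ℤ) : ℚ), ((-4 : ℤ) : ℚ)⟩ by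
    ext <;> norm_num]
  exact isGloballyMinimal_oneSeventySixA1_cast

/-- `176a1` is an elliptic curve (`Δ = −2816 ≠ 0`). [folklore] -/
theorem isElliptic_oneSeventySixA1 : (⟨0, 0, 0, -4, -4⟩ : WeierstrassCurve ℚ).IsElliptic :=
  ⟨by norm_num [WeierstrassCurve.Δ, WeierstrassCurve.b₂, WeierstrassCurve.b₄, WeierstrassCurve.b₆, WeierstrassCurve.b₈]⟩

/-- The aligned `χ₋₄`-edge: `88a1 ⊗ (−1) = 176a1` on the nose. [folklore] -/
theorem smul_quadraticTwist_eightyEightA1_negOne :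
    (1 : VariableChange ℚ) • (⟨0, 0, 0, -4, 4⟩ : WeierstrassCurve ℚ).quadraticTwist (-1) = ⟨0, 0, 0, -4, -4⟩ := by
  rw [one_smul]
  ext <;> simp only [quadraticTwist_a₁, quadraticTwist_a₂, quadraticTwist_a₃, quadraticTwist_a₄,
    quadraticTwist_a₆, b₂, b₄, b₆] <;> norm_num

/-- The discriminants agree: `Δ(176a1) = Δ(88a1)` (`r = 1`). [folklore] -/
theorem Δ_oneSeventySixA1_eq :
    (((1 : ℤ)) : ℚ) ^ 12 * (⟨0, 0, 0, -4, -4⟩ : WeierstrassCurve ℚ).Δ = (⟨0, 0, 0, -4, 4⟩ : WeierstrassCurve ℚ).Δ := by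
  norm_num [WeierstrassCurve.Δ, WeierstrassCurve.b₂, WeierstrassCurve.b₄, WeierstrassCurve.b₆, WeierstrassCurve.b₈]

/-- **`176a` TRANSPORT: `|c(D)| = 1`** for every lattice-optimal `X₀(176)`-datum whose odd coefficients are the `χ₋₄`-twists of those of `F₈₈`.
[cite: Stevens1989, Lemma (5.4) p. 97] [cite: AgasheRibetStein2006, §§1–2] [cite: CremonaAlgorithms1997, Table 1 (88a1, 176a1)] -/
theorem abs_maninConstant_eq_one_oneSeventySixA_of_cuspCoeff (W : WeierstrassCurve ℚ) [W.IsElliptic] [W.IsGloballyMinimal]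
    (D : ModularParametrizationData W 176) (hf : ∀ n : ℕ, ¬ 2 ∣ n → cuspCoeff D.f n = (ZMod.χ₄ n : ℂ) * cuspCoeff F88 n)
    (hopt : ∀ z ∈ D.L.lattice, ∃ w ∈ periodLattice D.f, z = D.c * w) : |D.maninConstant| = 1 := by
  haveI := LevelEightyEight.isElliptic_eightyEightA1
  haveI := isElliptic_oneSeventySixA1
  haveI := isGloballyMinimal_oneSeventySixA1
  obtain ⟨L₀, h2, h3⟩ := ((⟨0, 0, 0, -4, 4⟩ : WeierstrassCurve ℚ).baseChange ℂ).exists_periodPair_of_isElliptic'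
  have hL₀ : IsNeronLatticeOf ((⟨0, 0, 0, -4, 4⟩ : WeierstrassCurve ℚ).baseChange ℂ) L₀ := ⟨h2, h3⟩
  exact abs_maninConstant_eq_one_of_squeeze_negOneTwist_aligned_level ⟨22, rfl⟩ ⟨2, rfl⟩ ⟨11, rfl⟩ F88
    ⟨0, 0, 0, -4, 4⟩ L₀ hL₀ (periodLatticeLe_eightyEightA hL₀) cuspCoeff_F88_eq_zero
    (C := ⟨0, 0, 0, -4, -4⟩) 1 smul_quadraticTwist_eightyEightA1_negOne (r := 1) (Or.inl rfl)
    Δ_oneSeventySixA1_eq W D hf hopt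

/-! ## §3 The row `176a` against `F₈₈`'s own table (no `X₀(88)`-datum) -/

section Row

set_option maxHeartbeats 4000000
set_option maxRecDepth 16384

/-- Table of `Q2` to depth `64`. [cite: Koehler2011, §2.1] -/
def tQ2 : List ℤ := [0, 0, 0, 0, 0, 1, 0, 1, 0, -1, 0, 0, 0, -1, 0, -2, 0, 1, 0, -1, 0, -1, 0, 0, 0, 1, 0, 2, 0, 0, 0, 0, 0, 0, 0, 1, 0, -1, 0, 1, 0, -1,
  0, -2, 0, 2, 0, 2, 0, 0, 0, -3, 0, 2, 0, -1, 0, 3, 0, 2, 0, 0, 0, 2]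
/-- Table of `Q3` to depth `64`. [cite: Koehler2011, §2.1] -/
def tQ3 : List ℤ := [0, 1, 0, -3, 0, 1, 0, 2, 0, 2, 0, -1, 0, -4, 0, 1, 0, -2, 0, 0, 0, 2, 0, 1, 0, 8, 0, -1, 0, -8, 0, -7, 0, 3, 0, 10, 0, -5, 0, 4, 0, 0,
  0, -2, 0, -10, 0, 0, 0, -3, 0, 6, 0, 10, 0, -1, 0, 0, 0, 7, 0, 4, 0, -4]

/-- `Σ δ·r_δ` of `Q2`, `Q3`: `120 = 24·5`, `24 = 24·1`. [folklore] -/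
theorem sum_lQ : (∑ δ ∈ (88 : ℕ).divisors, (δ : ℤ) * expFn lQ2 δ = 24 * (5 : ℕ)) ∧
    (∑ δ ∈ (88 : ℕ).divisors, (δ : ℤ) * expFn lQ3 δ = 24 * (1 : ℕ)) := by unfold lQ2 lQ3; exact ⟨by decide, by decide⟩

/-- Sparse kernel `η`-certificate of `Q2` to depth `64`. [cite: Koehler2011, §2.1] -/
theorem hcertQ2 : mulList 64 tQ2 (etaDenListSparse 64 88 (expFn lQ2)) = etaNumListSparse 64 88 (expFn lQ2) 5 := by
  unfold lQ2; decide +kernel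
/-- Sparse kernel `η`-certificate of `Q3` to depth `64`. [cite: Koehler2011, §2.1] -/
theorem hcertQ3 : mulList 64 tQ3 (etaDenListSparse 64 88 (expFn lQ3)) = etaNumListSparse 64 88 (expFn lQ3) 1 := by
  unfold lQ3; decide +kernel

/-- an's `tab88a` IS `−4·tQ2 + tQ3` to depth `64` (kernel arithmetic). [folklore] -/
theorem tab88a_eq_comb : ∀ n < 64, tab88a.getD n 0 = -4 * tQ2.getD n 0 + tQ3.getD n 0 := by decide +kernel

/-- **`aₙ(F₈₈) = tab88a[n]` for `n < 64`** — an's root table, now attached to the EXPLICIT cusp form `F₈₈`. [cite: CremonaAlgorithms1997, Table 1 (88a)] -/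
theorem tab88a_eq_cuspCoeff_F88 : ∀ n < 64, ((tab88a.getD n 0 : ℤ) : ℂ) = cuspCoeff F88 n := by
  intro n hn
  have h2 := qExpansion_coeff_eq_of_etaCertificateSparse_cuspForm Q2c (expFn lQ2) (fun _ ↦ rfl) 5 sum_lQ.1 tQ2 hcertQ2 n hn
  have h3 := qExpansion_coeff_eq_of_etaCertificateSparse_cuspForm Q3c (expFn lQ3) (fun _ ↦ rfl) 1 sum_lQ.2 tQ3 hcertQ3 n hn
  rw [tab88a_eq_comb n hn, F88, cuspCoeff_add_form (one_mem_strictPeriods_coe_gamma0 88), cuspCoeff_smul]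
  unfold cuspCoeff
  rw [← h2, ← h3]
  push_cast
  ring

/-- **`aₙ((F₈₈)^{χ₋₄}) = tabTa[n]` for `n < 64`.** [cite: Shimura1971, Prop. 3.64] -/
theorem tabTa_eq_modCoef_charTwist_F88 :
    ∀ n < 64, ((tabTa.getD n 0 : ℤ) : ℂ) = modCoefₗ 176 2 n (ModularFormClass.modularForm
      (charTwist 176 (⟨2, rfl⟩ : 88 ∣ 176) (⟨11, rfl⟩ : 4 ^ 2 ∣ 176) isQuadratic_χ₄_ringHomComp F88)) := by
  intro n hn
  have h := hTwa n hn
  rw [← ZMod.χ₄_nat_eq_if_mod_four] at h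
  have hc : ((tabTa.getD n 0 : ℤ) : ℂ) = ((ZMod.χ₄ n : ℤ) : ℂ) * ((tab88a.getD n 0 : ℤ) : ℂ) := by
    exact_mod_cast h
  rw [modCoefₗ_modularForm, cuspCoeff_charTwist 176 _ _ isQuadratic_χ₄_ringHomComp isPrimitive_χ₄_ringHomComp,
    χ₄_ringHomComp_apply_natCast, ← tab88a_eq_cuspCoeff_F88 n hn]
  exact hc

/-- **Row `176a`, datum-free**: if `(a_p(W))_p = σ₁₇₆ₐ` then `D.f = (F₈₈)^{χ₋₄}`. [cite: CremonaAlgorithms1997, Table 1 (176a, 88a)] [cite: Shimura1971, Prop. 3.64] -/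
theorem f_eq_charTwist_F88 {W : WeierstrassCurve ℚ} [W.IsElliptic] (D : ModularParametrizationData W 176)
    (hA : truth W [2, 3, 5, 7, 13, 17, 11, 19, 23, 29, 31] = rowA.1) :
    D.f = charTwist 176 (⟨2, rfl⟩ : 88 ∣ 176) (⟨11, rfl⟩ : 4 ^ 2 ∣ 176) isQuadratic_χ₄_ringHomComp F88 := by
  haveI : FiniteDimensional ℂ (ModularForm (Gamma0 176) 2) := Module.finite_of_finrank_eq_succ finrank_modularForm_two
  obtain ⟨C, hC, c, hc, htruth, hpin⟩ := pinning D
  have ht := tables_of_etaCertsSparse 176 64 (fun i : Fin 30 ↦ expFn (Ls[(i : ℕ)]).1) (fun i ↦ shifts i) tabs C hC hshift hcert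
  rw [stages_map_fst] at htruth
  rw [goodCerts_eq_rows] at hc
  simp only [List.mem_cons, List.mem_nil_iff, or_false] at hc
  rcases hc with rfl | rfl | rfl
  · exact absurd (htruth.symm.trans hA) rows_ne.2.1
  · exact absurd (htruth.symm.trans hA) rows_ne.2.2
  · exact cuspForm_eq_of_modularForm_eq (eq_of_smul_eq_sum_of_row C tabs duals 45724800 ht hlen hdual (by norm_num)
      finrank_modularForm_two _ tabTa tabTa_eq_modCoef_charTwist_F88 rowA.2.1 (by decide) rowA.2.2 hpin hrowA)

end Row

/-- **The `176a` row selected by `a₃(W) = 3`**: `D.f = (F₈₈)^{χ₋₄}`. [cite: CremonaAlgorithms1997, Table 1 (176a)] -/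
theorem f_eq_charTwist_F88_of_lFunction_three {W : WeierstrassCurve ℚ} [W.IsElliptic] (D : ModularParametrizationData W 176)
    (h3 : W.LFunction 3 = 3) :
    D.f = charTwist 176 (⟨2, rfl⟩ : 88 ∣ 176) (⟨11, rfl⟩ : 4 ^ 2 ∣ 176) isQuadratic_χ₄_ringHomComp F88 := by
  obtain ⟨φ, hφ⟩ := exists_cuspForm_phi44
  rcases f_eq_charTwist_or D φ hφ with ⟨h, _⟩ | ⟨h, _⟩ | h
  · have h' := lFunction_three_of_truth rowC h
    simp only [rowC, List.getD_cons_succ, List.getD_cons_zero] at h'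
    rw [h3] at h'
    norm_num at h'
  · have h' := lFunction_three_of_truth rowB h
    simp only [rowB, List.getD_cons_succ, List.getD_cons_zero] at h'
    rw [h3] at h'
    norm_num at h'
  · exact f_eq_charTwist_F88 D h

/-- **`176a`: `|c(D)| = 1` for every lattice-optimal `X₀(176)`-datum with `a₃(W) = 3`** — UNCONDITIONAL and datum-free.
[cite: AgasheRibetStein2006, §§1–2] [cite: CremonaAlgorithms1997, Table 1 (88a1, 176a1)] -/
theorem abs_maninConstant_eq_one_oneSeventySix_of_lFunction_three_eq_three (W : WeierstrassCurve ℚ) [W.IsElliptic] [W.IsGloballyMinimal]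
    (D : ModularParametrizationData W 176) (h3 : W.LFunction 3 = 3)
    (hopt : ∀ z ∈ D.L.lattice, ∃ w ∈ periodLattice D.f, z = D.c * w) : |D.maninConstant| = 1 :=
  abs_maninConstant_eq_one_oneSeventySixA_of_cuspCoeff W D
    (fun n _ ↦ by
      rw [f_eq_charTwist_F88_of_lFunction_three D h3,
        cuspCoeff_charTwist 176 _ _ isQuadratic_χ₄_ringHomComp isPrimitive_χ₄_ringHomComp, χ₄_ringHomComp_apply_natCast])
    hopt

/-- **`176a ∪ 176c`: `|c(D)| = 1` for every lattice-optimal `X₀(176)`-datum with `a₃(W) ≠ 1`** (`a₃ ∈ {−1, 1, 3}` by the kernel; the row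
`176b = (11a)^{χ₋₄}`, `a₃ = 1`, is not treated here). [cite: AgasheRibetStein2006, §§1–2] -/
theorem abs_maninConstant_eq_one_oneSeventySix_of_lFunction_three_ne_one (W : WeierstrassCurve ℚ) [W.IsElliptic] [W.IsGloballyMinimal]
    (D : ModularParametrizationData W 176) (h3 : W.LFunction 3 ≠ 1)
    (hopt : ∀ z ∈ D.L.lattice, ∃ w ∈ periodLattice D.f, z = D.c * w) : |D.maninConstant| = 1 := by
  rcases lFunction_three_cases D with h | h | h
  · exact abs_maninConstant_eq_one_oneSeventySix_of_lFunction_three_eq_neg_one W D h hopt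
  · exact absurd h h3
  · exact abs_maninConstant_eq_one_oneSeventySix_of_lFunction_three_eq_three W D h hopt

end Summit.BirchSwinnertonDyer.BirchSwinnertonDyer.Theorems.ManinLocalTwoThree.LevelOneSeventySix

end
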